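import Summits.QuantumFields.YangMills.Theorems.AllWindowsColdBoxBoxHighLineHodgePoincareFun

/-!
# LINE-19, toward S3a `LandauVarianceBounded` (crux `AllWindowsColdBox.BoxHighWindowsSU22`, stmt-QuantumFields-24004 / low item 24335),
# part 1: the Pólya simplex flow on a three-dimensional slice of `ℤ⁴` — conservation and pointwise energy

For a direction `i`, a source `x ∈ ℤ⁴` and a side length `N`, the SIMPLEX FLOW lives on the slice `{y_i = x_i}`, on the edges in the
three directions `τ ≠ i`, inside the region `x_τ ≤ y_τ ≤ N − 1`:
`θ(y, τ) = φ(m) · (y_τ − x_τ + 1)/(m + 3)`, `φ(m) = 2/((m+1)(m+2))`, `m = m(y) = Σ_{τ≠i} (y_τ − x_τ)` (the 3-colour Pólya-urn weights: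
the vertex flux `φ(m)` is uniform on each simplex `m = const`).  Both `m` and `θ` enter as hypotheses-defined functions (no definitions).
* `outflow`, `inflow`, `divergence` — exact conservation: the divergence is `1` at the source and `0` elsewhere in the region;
* `divergence_zero_of_not_region` — zero divergence off the slice and behind the source;
* `energy_pointwise` — `Σ_{τ≠i} θ(y,τ)² ≤ 𝟙_region(y)·φ(m(y))²`.
Parts 2–3 sum the energy (`≤ 4`, the tree's `sum_theta_sq_le_four`) and derive the lattice Sobolev bound `g(x)² ≤ 4·Σ_{τ≠i}‖∇_τ g‖²`.
Mathlib only (via the S1 files).  HONEST LABEL: helper toward the first conjunct (S3a `LandauVarianceBounded`) of registered stub S3 of a critic-PASSed line on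
the R2ξ″ crux ⟨24004⟩; no crux, rung or summit is proved; the Yang–Mills mass gap is NOT proved by this file.
-/

set_option autoImplicit false

open Finset

namespace Summit.QuantumFields.YangMills.Theorems.AllWindowsColdBoxBoxHighLine.HodgePoincare

/-! ## The Pólya simplex flow on a three-dimensional slice and the lattice Sobolev bound -/

/-- The number of directions other than `i` is three. -/
theorem card_ne (i : Fin 4) : (Finset.univ.filter (fun k : Fin 4 => k ≠ i)).card = 3 := by
  rw [Finset.filter_ne' Finset.univ i, Finset.card_erase_of_mem (Finset.mem_univ i)]; simp

/-- Coordinate `τ` of `y − e_τ`. -/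
theorem sub_single_apply_same (y : Fin 4 → ℤ) (τ : Fin 4) : (y - Pi.single τ (1 : ℤ) : Fin 4 → ℤ) τ = y τ - 1 := by
  simp

/-- Coordinates `k ≠ τ` of `y − e_τ`. -/
theorem sub_single_apply_ne (y : Fin 4 → ℤ) {τ k : Fin 4} (h : k ≠ τ) : (y - Pi.single τ (1 : ℤ) : Fin 4 → ℤ) k = y k := by
  rw [Pi.sub_apply, Pi.single_eq_of_ne h, sub_zero]

section Flow

variable {N : ℕ} {i : Fin 4} {x : Fin 4 → ℤ}

/-- Generation of a predecessor: `m(y − e_τ) = m(y) − 1` for `τ ≠ i`. -/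
theorem m_sub (m : (Fin 4 → ℤ) → ℤ) (hm : ∀ y, m y = ∑ k : Fin 4, (if k ≠ i then y k - x k else 0))
    (y : Fin 4 → ℤ) {τ : Fin 4} (hτ : τ ≠ i) : m (y - Pi.single τ 1) = m y - 1 := by
  rw [hm, hm]
  have hpt : ∀ k : Fin 4, (if k ≠ i then (y - Pi.single τ (1 : ℤ) : Fin 4 → ℤ) k - x k else 0) =
      (if k ≠ i then y k - x k else 0) - (if k = τ then 1 else 0) := by
    intro k
    by_cases hk : k = τ
    · subst hk
      rw [if_pos hτ, if_pos hτ, if_pos rfl, sub_single_apply_same]; ring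
    · rw [sub_single_apply_ne y hk, if_neg hk, sub_zero]
  rw [Finset.sum_congr rfl fun k _ => hpt k, Finset.sum_sub_distrib, Finset.sum_ite_eq' Finset.univ τ]
  simp

/-- In the region the generation is non-negative. -/
theorem m_nonneg (m : (Fin 4 → ℤ) → ℤ) (hm : ∀ y, m y = ∑ k : Fin 4, (if k ≠ i then y k - x k else 0))
    {y : Fin 4 → ℤ} (hy : ∀ k, k ≠ i → x k ≤ y k ∧ y k + 1 ≤ N) : 0 ≤ m y := by
  rw [hm]
  refine Finset.sum_nonneg fun k _ => ?_
  by_cases h : k ≠ i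
  · rw [if_pos h]; have := hy k h; omega
  · rw [if_neg h]

/-- Away from the source the generation is at least one. -/
theorem one_le_m (m : (Fin 4 → ℤ) → ℤ) (hm : ∀ y, m y = ∑ k : Fin 4, (if k ≠ i then y k - x k else 0))
    {y : Fin 4 → ℤ} (hyi : y i = x i) (hy : ∀ k, k ≠ i → x k ≤ y k ∧ y k + 1 ≤ N) (hne : y ≠ x) : 1 ≤ m y := by
  obtain ⟨k, hk⟩ : ∃ k, y k ≠ x k := by
    by_contra h; push Not at h; exact hne (funext h)
  have hki : k ≠ i := fun h => hk (h ▸ hyi)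
  have h1 : (1 : ℤ) ≤ (if k ≠ i then y k - x k else 0) := by rw [if_pos hki]; have := hy k hki; omega
  rw [hm]
  refine le_trans h1 (Finset.single_le_sum (f := fun k' => if k' ≠ i then y k' - x k' else 0) (fun k' _ => ?_)
    (Finset.mem_univ k))
  by_cases h : k' ≠ i
  · rw [if_pos h]; have := hy k' h; omega
  · rw [if_neg h]

/-- The generation vanishes exactly at the source. -/
theorem m_eq_zero_iff (m : (Fin 4 → ℤ) → ℤ) (hm : ∀ y, m y = ∑ k : Fin 4, (if k ≠ i then y k - x k else 0))
    {y : Fin 4 → ℤ} (hyi : y i = x i) (hy : ∀ k, k ≠ i → x k ≤ y k ∧ y k + 1 ≤ N) : m y = 0 ↔ y = x := by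
  constructor
  · intro h0; by_contra hne; have := one_le_m m hm hyi hy hne; omega
  · intro h; subst h; rw [hm]; simp

/-- The generation as a real sum. -/
theorem m_cast (m : (Fin 4 → ℤ) → ℤ) (hm : ∀ y, m y = ∑ k : Fin 4, (if k ≠ i then y k - x k else 0))
    (y : Fin 4 → ℤ) : ((m y : ℤ) : ℝ) = ∑ τ : Fin 4, (if τ ≠ i then ((y τ - x τ : ℤ) : ℝ) else 0) := by
  rw [hm, Int.cast_sum]
  refine Finset.sum_congr rfl fun τ _ => ?_
  split_ifs <;> simp

/-- `Σ_{τ ≠ i} 1 = 3`. -/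
theorem sum_ite_ne_one (i : Fin 4) : ∑ τ : Fin 4, (if τ ≠ i then (1 : ℝ) else 0) = 3 := by
  rw [Finset.sum_ite, Finset.sum_const_zero, add_zero, Finset.sum_const, card_ne]; simp

variable (m : (Fin 4 → ℤ) → ℤ) (hm : ∀ y, m y = ∑ k : Fin 4, (if k ≠ i then y k - x k else 0))
  (θ : (Fin 4 → ℤ) → Fin 4 → ℝ)
  (hθ : ∀ y τ, θ y τ = if (τ ≠ i ∧ y i = x i ∧ ∀ k, k ≠ i → x k ≤ y k ∧ y k + 1 ≤ N) then
    2 / (((m y : ℝ) + 1) * ((m y : ℝ) + 2)) * (((y τ - x τ : ℤ) : ℝ) + 1) / ((m y : ℝ) + 3) else 0)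

include hm hθ in
/-- **Outflow**: at a point of the region the out-weights sum to `φ(m) = 2/((m+1)(m+2))`. -/
theorem outflow {y : Fin 4 → ℤ} (hyi : y i = x i) (hy : ∀ k, k ≠ i → x k ≤ y k ∧ y k + 1 ≤ N) :
    ∑ τ : Fin 4, (if τ ≠ i then θ y τ else 0) = 2 / (((m y : ℝ) + 1) * ((m y : ℝ) + 2)) := by
  have hsum : ∑ τ : Fin 4, (if τ ≠ i then (((y τ - x τ : ℤ) : ℝ) + 1) else 0) = (m y : ℝ) + 3 := by
    have h1 : ∑ τ : Fin 4, (if τ ≠ i then (((y τ - x τ : ℤ) : ℝ) + 1) else 0) =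
        ∑ τ : Fin 4, (if τ ≠ i then ((y τ - x τ : ℤ) : ℝ) else 0) + ∑ τ : Fin 4, (if τ ≠ i then (1 : ℝ) else 0) := by
      rw [← Finset.sum_add_distrib]
      refine Finset.sum_congr rfl fun τ _ => ?_
      by_cases h : τ ≠ i
      · rw [if_pos h, if_pos h, if_pos h]
      · rw [if_neg h, if_neg h, if_neg h, add_zero]
    rw [h1, ← m_cast m hm y, sum_ite_ne_one]
  have hm0 : (0 : ℝ) ≤ (m y : ℝ) := by exact_mod_cast m_nonneg m hm hy
  have hterm : ∀ τ : Fin 4, (if τ ≠ i then θ y τ else 0) =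
      2 / (((m y : ℝ) + 1) * ((m y : ℝ) + 2)) / ((m y : ℝ) + 3) * (if τ ≠ i then (((y τ - x τ : ℤ) : ℝ) + 1) else 0) := by
    intro τ
    by_cases hτ : τ ≠ i
    · rw [if_pos hτ, if_pos hτ, hθ, if_pos ⟨hτ, hyi, hy⟩]; ring
    · rw [if_neg hτ, if_neg hτ, mul_zero]
  rw [Finset.sum_congr rfl fun τ _ => hterm τ, ← Finset.mul_sum, hsum]
  field_simp

include hm hθ in
/-- **Inflow**: at a point of the region the in-weights sum to `φ(m−1)·m/(m+2)` (which is `0` at the source). -/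
theorem inflow {y : Fin 4 → ℤ} (hyi : y i = x i) (hy : ∀ k, k ≠ i → x k ≤ y k ∧ y k + 1 ≤ N) :
    ∑ τ : Fin 4, (if τ ≠ i then θ (y - Pi.single τ 1) τ else 0) =
      2 / ((m y : ℝ) * ((m y : ℝ) + 1)) / ((m y : ℝ) + 2) * (m y : ℝ) := by
  have hterm : ∀ τ : Fin 4, τ ≠ i → θ (y - Pi.single τ 1) τ =
      2 / ((m y : ℝ) * ((m y : ℝ) + 1)) / ((m y : ℝ) + 2) * ((y τ - x τ : ℤ) : ℝ) := by
    intro τ hτ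
    rw [hθ, m_sub m hm y hτ]
    have hτi : (y - Pi.single τ 1 : Fin 4 → ℤ) i = x i := by rw [sub_single_apply_ne y (Ne.symm hτ), hyi]
    have hττ := sub_single_apply_same y τ
    by_cases hpred : x τ ≤ y τ - 1
    · have hreg : ∀ k, k ≠ i → x k ≤ (y - Pi.single τ 1 : Fin 4 → ℤ) k ∧ (y - Pi.single τ 1 : Fin 4 → ℤ) k + 1 ≤ N := by
        intro k hk
        by_cases hkτ : k = τ
        · subst hkτ; rw [hττ]; have := hy k hk; constructor <;> omega
        · rw [sub_single_apply_ne y hkτ]; exact hy k hk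
      rw [if_pos ⟨hτ, hτi, hreg⟩, hττ]
      push_cast; ring
    · have hzero : y τ = x τ := by have := hy τ hτ; omega
      rw [if_neg, hzero, sub_self]
      · push_cast; ring
      · rintro ⟨-, -, hreg⟩
        have := (hreg τ hτ).1; rw [hττ] at this; omega
  have hpt : ∀ τ : Fin 4, (if τ ≠ i then θ (y - Pi.single τ 1) τ else 0) =
      2 / ((m y : ℝ) * ((m y : ℝ) + 1)) / ((m y : ℝ) + 2) * (if τ ≠ i then ((y τ - x τ : ℤ) : ℝ) else 0) := by
    intro τ
    by_cases hτ : τ ≠ i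
    · rw [if_pos hτ, if_pos hτ, hterm τ hτ]
    · rw [if_neg hτ, if_neg hτ, mul_zero]
  rw [Finset.sum_congr rfl fun τ _ => hpt τ, ← Finset.mul_sum, ← m_cast m hm y]

include hm hθ in
/-- **Conservation**: in the region, the divergence of the flow is `1` at the source and `0` elsewhere. -/
theorem divergence {y : Fin 4 → ℤ} (hyi : y i = x i) (hy : ∀ k, k ≠ i → x k ≤ y k ∧ y k + 1 ≤ N) :
    ∑ τ : Fin 4, (if τ ≠ i then θ y τ - θ (y - Pi.single τ 1) τ else 0) = if y = x then 1 else 0 := by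
  have hsplit : ∑ τ : Fin 4, (if τ ≠ i then θ y τ - θ (y - Pi.single τ 1) τ else 0) =
      ∑ τ : Fin 4, (if τ ≠ i then θ y τ else 0) - ∑ τ : Fin 4, (if τ ≠ i then θ (y - Pi.single τ 1) τ else 0) := by
    rw [← Finset.sum_sub_distrib]
    refine Finset.sum_congr rfl fun τ _ => ?_
    by_cases h : τ ≠ i
    · rw [if_pos h, if_pos h, if_pos h]
    · rw [if_neg h, if_neg h, if_neg h, sub_zero]
  rw [hsplit, outflow m hm θ hθ hyi hy, inflow m hm θ hθ hyi hy]
  by_cases hyx : y = x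
  · have h0 : m y = 0 := (m_eq_zero_iff m hm hyi hy).2 hyx
    rw [if_pos hyx, h0]; push_cast; norm_num
  · have h1 : (1 : ℝ) ≤ (m y : ℝ) := by exact_mod_cast one_le_m m hm hyi hy hyx
    rw [if_neg hyx]
    have hne : (m y : ℝ) ≠ 0 := by linarith
    have hne1 : (m y : ℝ) + 1 ≠ 0 := by linarith
    have hne2 : (m y : ℝ) + 2 ≠ 0 := by linarith
    field_simp
    ring

include hθ in
/-- Off the slice or behind the source the flow has zero divergence. -/
theorem divergence_zero_of_not_region {y : Fin 4 → ℤ} (hy : ¬ (y i = x i ∧ ∀ k, k ≠ i → x k ≤ y k)) :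
    ∑ τ : Fin 4, (if τ ≠ i then θ y τ - θ (y - Pi.single τ 1) τ else 0) = 0 := by
  refine Finset.sum_eq_zero fun τ _ => ?_
  by_cases hτ : τ ≠ i
  · rw [if_pos hτ]
    have h1 : θ y τ = 0 := by
      rw [hθ, if_neg]
      rintro ⟨-, hyi, hreg⟩
      exact hy ⟨hyi, fun k hk => (hreg k hk).1⟩
    have h2 : θ (y - Pi.single τ 1) τ = 0 := by
      rw [hθ, if_neg]
      rintro ⟨-, hyi, hreg⟩
      apply hy
      rw [sub_single_apply_ne y (Ne.symm hτ)] at hyi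
      refine ⟨hyi, fun k hk => ?_⟩
      have := (hreg k hk).1
      by_cases hkτ : k = τ
      · subst hkτ; rw [sub_single_apply_same] at this; omega
      · rw [sub_single_apply_ne y hkτ] at this; exact this
    rw [h1, h2, sub_zero]
  · rw [if_neg hτ]

include hm hθ in
/-- Pointwise energy: `Σ_{τ ≠ i} θ(y,τ)² ≤ 𝟙_region(y) · φ(m(y))²`. -/
theorem energy_pointwise (y : Fin 4 → ℤ) :
    ∑ τ : Fin 4, (if τ ≠ i then θ y τ ^ 2 else 0) ≤
      if (y i = x i ∧ ∀ k, k ≠ i → x k ≤ y k ∧ y k + 1 ≤ N) then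
        (2 / (((m y : ℝ) + 1) * ((m y : ℝ) + 2))) ^ 2 else 0 := by
  by_cases hR : y i = x i ∧ ∀ k, k ≠ i → x k ≤ y k ∧ y k + 1 ≤ N
  · rw [if_pos hR]
    obtain ⟨hyi, hy⟩ := hR
    have hm0 : (0 : ℝ) ≤ (m y : ℝ) := by exact_mod_cast m_nonneg m hm hy
    have hnn : ∀ τ : Fin 4, 0 ≤ (if τ ≠ i then (((y τ - x τ : ℤ) : ℝ) + 1) / ((m y : ℝ) + 3) else 0) := by
      intro τ
      by_cases h : τ ≠ i
      · rw [if_pos h]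
        have : (0 : ℝ) ≤ ((y τ - x τ : ℤ) : ℝ) := by
          have := hy τ h; exact_mod_cast (by omega : (0 : ℤ) ≤ y τ - x τ)
        positivity
      · rw [if_neg h]
    have hcsum : ∑ τ : Fin 4, (if τ ≠ i then (((y τ - x τ : ℤ) : ℝ) + 1) / ((m y : ℝ) + 3) else 0) = 1 := by
      have h1 : ∑ τ : Fin 4, (if τ ≠ i then (((y τ - x τ : ℤ) : ℝ) + 1) / ((m y : ℝ) + 3) else 0) =
          (∑ τ : Fin 4, (if τ ≠ i then ((y τ - x τ : ℤ) : ℝ) else 0) + ∑ τ : Fin 4, (if τ ≠ i then (1 : ℝ) else 0)) /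
            ((m y : ℝ) + 3) := by
        rw [← Finset.sum_add_distrib, Finset.sum_div]
        refine Finset.sum_congr rfl fun τ _ => ?_
        by_cases h : τ ≠ i
        · rw [if_pos h, if_pos h, if_pos h]
        · rw [if_neg h, if_neg h, if_neg h, add_zero, zero_div]
      rw [h1, ← m_cast m hm y, sum_ite_ne_one]
      field_simp
    have hle1 : ∀ τ : Fin 4, (if τ ≠ i then (((y τ - x τ : ℤ) : ℝ) + 1) / ((m y : ℝ) + 3) else 0) ≤ 1 := by
      intro τ
      exact le_of_le_of_eq (Finset.single_le_sum
        (f := fun τ' : Fin 4 => if τ' ≠ i then (((y τ' - x τ' : ℤ) : ℝ) + 1) / ((m y : ℝ) + 3) else 0)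
        (fun τ' _ => hnn τ') (Finset.mem_univ τ)) hcsum
    have hterm : ∀ τ : Fin 4, (if τ ≠ i then θ y τ ^ 2 else 0) =
        (2 / (((m y : ℝ) + 1) * ((m y : ℝ) + 2))) ^ 2 *
          (if τ ≠ i then (((y τ - x τ : ℤ) : ℝ) + 1) / ((m y : ℝ) + 3) else 0) ^ 2 := by
      intro τ
      by_cases hτ : τ ≠ i
      · rw [if_pos hτ, if_pos hτ, hθ, if_pos ⟨hτ, hyi, hy⟩]; ring
      · rw [if_neg hτ, if_neg hτ]; ring
    rw [Finset.sum_congr rfl fun τ _ => hterm τ, ← Finset.mul_sum]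
    have hsq : ∑ τ : Fin 4, (if τ ≠ i then (((y τ - x τ : ℤ) : ℝ) + 1) / ((m y : ℝ) + 3) else 0) ^ 2 ≤ 1 := by
      calc ∑ τ : Fin 4, (if τ ≠ i then (((y τ - x τ : ℤ) : ℝ) + 1) / ((m y : ℝ) + 3) else 0) ^ 2
          ≤ ∑ τ : Fin 4, (if τ ≠ i then (((y τ - x τ : ℤ) : ℝ) + 1) / ((m y : ℝ) + 3) else 0) :=
            Finset.sum_le_sum fun τ _ => by have := hnn τ; have := hle1 τ; nlinarith
        _ = 1 := hcsum
    have : 0 ≤ (2 / (((m y : ℝ) + 1) * ((m y : ℝ) + 2))) ^ 2 := sq_nonneg _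
    nlinarith
  · rw [if_neg hR]
    refine le_of_eq (Finset.sum_eq_zero fun τ _ => ?_)
    by_cases hτ : τ ≠ i
    · rw [if_pos hτ, hθ, if_neg (fun h => hR ⟨h.2.1, h.2.2⟩)]; ring
    · rw [if_neg hτ]

end Flow


end Summit.QuantumFields.YangMills.Theorems.AllWindowsColdBoxBoxHighLine.HodgePoincare
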